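import Mathlib.FieldTheory.IsRealClosed.Basic
import Mathlib.FieldTheory.Galois.Basic
import Mathlib.FieldTheory.PrimitiveElement
import Mathlib.FieldTheory.Perfect
import Mathlib.FieldTheory.SplittingField.Construction
import Mathlib.GroupTheory.Sylow
import Mathlib.LinearAlgebra.FiniteDimensional.Lemmas
import Mathlib.Algebra.CharP.IntermediateField
import HarnessLib

/-!
# Finite extensions of a real closed field have degree at most two

For a real closed field `K` in Mathlib's sense (`IsRealClosed K`: `K` is real, every element or
its negative is a square, every odd-degree polynomial has a root; here always taken together with
its order `[LinearOrder K] [IsStrictOrderedRing K]`) we prove the algebraic half of the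
fundamental theorem of algebra over `K`:

* `finrank_eq_one_of_odd_finrank`: a finite extension of `K` of odd degree is trivial;
* `exists_card_aut_eq_two_pow`: the Galois group of a finite Galois extension of `K` is a
  `2`-group (Sylow `2`-subgroup + the previous point applied to its fixed field);
* `finrank_le_two_of_isGalois`: a finite Galois extension of `K` has degree `≤ 2` (a `2`-group of
  order `≥ 4` gives a tower of two quadratic extensions `K ⊂ M₂ ⊂ M₁`; but `M₂ = K(√a)` with
  `a < 0` has all its elements squares, so it has no quadratic extension);
* `natDegree_le_two_of_irreducible`: irreducible polynomials over `K` have degree `≤ 2`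
  (Bochnak–Coste–Roy 1998, Thm. 1.2.2; Basu–Pollack–Roy 2006, Thm. 2.11 `a) ⇒ b)` and
  Prop. 2.19).

This is E. Artin's variation of Gauss' proof, as printed for `ℝ` in Lang, *Undergraduate Algebra*,
Thm. VII.4.10, whose proof uses exactly the two real closed field axioms ("every polynomial of odd
degree has a root, every positive element is a square"). Basu–Pollack–Roy prove the same statement
(Thm. 2.11, `a) ⇒ b)`) by Laplace's argument with symmetric functions instead; we follow the
Galois-theoretic route because Mathlib has Sylow theory and the Galois correspondence.

Auxiliary algebra: square roots in `K(√a)`, `a < 0` (`exists_sq_eq_of_mul_self_eq`), and the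
structure of quadratic extensions in characteristic `0` (`exists_gen_of_finrank_eq_two`).

## References

* S. Lang, *Undergraduate Algebra*, Springer (1987), Thm. VII.4.10 and its proof.
* S. Basu, R. Pollack, M.-F. Roy, *Algorithms in Real Algebraic Geometry*, 2nd ed. (2006),
  Thm. 2.11, Prop. 2.19.
* J. Bochnak, M. Coste, M.-F. Roy, *Real Algebraic Geometry* (1998), Thm. 1.2.2.
-/

noncomputable section

open Polynomial Module
open scoped IntermediateField

namespace Literature.FieldTheory.RealClosed

/-! ### Square roots -/

section SquareRoots

variable {K : Type*} [Field K] [LinearOrder K] [IsStrictOrderedRing K] [IsRealClosed K]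

/-- In a real closed field every nonnegative element has a nonnegative square root.
[cite: BasuPollackRoy2006, §2.1 (definition of real closed field), Thm. 2.11] -/
theorem exists_nonneg_mul_self_eq {x : K} (hx : 0 ≤ x) : ∃ r : K, 0 ≤ r ∧ r * r = x := by
  obtain ⟨s, hs⟩ := IsSquare.of_nonneg hx
  exact ⟨|s|, abs_nonneg s, by rw [abs_mul_abs_self]; exact hs.symm⟩

/-- In a real closed field an element which is not a square is negative. [folklore] -/
theorem neg_of_not_isSquare {a : K} (ha : ¬ IsSquare a) : a < 0 := by
  by_contra h
  exact ha (IsSquare.of_nonneg (not_lt.mp h))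

/-- **Square roots in `K(√a)`, `a < 0`.** If `K` is real closed, `a < 0` and `y` is a square root
of `a` in some extension field, then every element `u + v y` (`u, v ∈ K`) is the square of an
element of the same form (the classical formula for complex square roots; Lang, *Undergraduate
Algebra*, proof of Thm. VII.4.10: "every complex number has a square root ... using only the fact
that a positive real number is the square of a real number"). [folklore] -/
theorem exists_sq_eq_of_mul_self_eq {M : Type*} [Field M] [Algebra K M] {a : K} (ha : a < 0)
    {y : M} (hy : y * y = algebraMap K M a) (u v : K) :
    ∃ s t : K, (algebraMap K M s + algebraMap K M t * y) ^ 2 =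
      algebraMap K M u + algebraMap K M v * y := by
  -- it suffices to solve `s² + a t² = u`, `2 s t = v` in `K`
  suffices h : ∃ s t : K, s * s + a * (t * t) = u ∧ 2 * s * t = v by
    obtain ⟨s, t, h1, h2⟩ := h
    refine ⟨s, t, ?_⟩
    rw [← h1, ← h2]
    simp only [map_add, map_mul, map_ofNat]
    linear_combination (algebraMap K M t * algebraMap K M t) * hy
  by_cases hA : v = 0 ∧ u ≤ 0
  · -- `u ≤ 0`, `v = 0`: take `s = 0`, `t = √(u / a)`
    obtain ⟨hv, hu⟩ := hA
    have hua : 0 ≤ u / a := by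
      rw [← neg_div_neg_eq]; exact div_nonneg (neg_nonneg.mpr hu) (neg_nonneg.mpr ha.le)
    obtain ⟨t, -, ht⟩ := exists_nonneg_mul_self_eq hua
    refine ⟨0, t, ?_, by simp [hv]⟩
    rw [ht, zero_mul, zero_add, mul_div_cancel₀ u ha.ne]
  · -- otherwise `u + r > 0` where `r = √(u² - a v²)`, `s = √((u + r) / 2)`, `t = v / (2 s)`
    have hr0 : 0 ≤ u * u + -a * (v * v) :=
      add_nonneg (mul_self_nonneg u) (mul_nonneg (neg_nonneg.mpr ha.le) (mul_self_nonneg v))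
    obtain ⟨r, hr, hrr⟩ := exists_nonneg_mul_self_eq hr0
    have hw : 0 < u + r := by
      by_cases hv : v = 0
      · have hu : 0 < u := by
          by_contra hu
          exact hA ⟨hv, not_lt.mp hu⟩
        linarith
      · have hvv : 0 < v * v := mul_self_pos.mpr hv
        have h1 : u * u < r * r := by
          rw [hrr]; linarith [mul_pos (neg_pos.mpr ha) hvv]
        by_contra hle
        have h3 : r ≤ -u := by linarith
        have h4 : r * r ≤ (-u) * (-u) := mul_self_le_mul_self hr h3
        linarith
    obtain ⟨s, -, hss⟩ :=
      exists_nonneg_mul_self_eq (div_nonneg hw.le zero_le_two : (0 : K) ≤ (u + r) / 2)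
    have hs0 : s ≠ 0 := by
      rintro rfl
      have : (u + r) / 2 = 0 := by rw [← hss, zero_mul]
      linarith [div_pos hw two_pos]
    have e2 : 2 * (s * s) = u + r := by rw [hss]; field_simp
    refine ⟨s, v / (2 * s), ?_, by field_simp⟩
    have e1 : 2 * s * (v / (2 * s)) = v := by field_simp
    have h4s : (4 * (s * s)) * (s * s + a * (v / (2 * s) * (v / (2 * s)))) = (4 * (s * s)) * u := by
      linear_combination (2 * (s * s) + u + r - 2 * u) * e2 +
        (a * (2 * s * (v / (2 * s)) + v)) * e1 + hrr
    exact mul_left_cancel₀ (mul_ne_zero four_ne_zero (mul_ne_zero hs0 hs0)) h4s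

end SquareRoots

/-! ### Quadratic extensions -/

section Quadratic

variable {F E : Type*} [Field F] [Field E] [Algebra F E]

/-- **Quadratic extensions in characteristic zero.** If `[E : F] = 2` (and `char F = 0`) then
`E = F(y)` with `y² = a ∈ F`, `a` not a square in `F`, and every element of `E` is `u + v y`
with `u, v ∈ F` (completing the square; Lang, *Undergraduate Algebra*, proof of Thm. VII.4.10:
"every such extension is generated by the root of a polynomial `t² - β`"). [folklore] -/
theorem exists_gen_of_finrank_eq_two [CharZero F] (h2 : finrank F E = 2) :
    ∃ a : F, ¬ IsSquare a ∧ ∃ y : E, y * y = algebraMap F E a ∧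
      ∀ z : E, ∃ u v : F, z = algebraMap F E u + algebraMap F E v * y := by
  haveI : FiniteDimensional F E := Module.finite_of_finrank_eq_succ h2
  haveI : CharZero E := charZero_of_injective_algebraMap (algebraMap F E).injective
  -- an element of `E` outside `F`
  obtain ⟨x, hx⟩ : ∃ x : E, x ∉ Set.range (algebraMap F E) := by
    by_contra! hall
    have hbt : (⊥ : IntermediateField F E) = ⊤ := by
      refine le_antisymm bot_le fun z _ => ?_
      exact IntermediateField.mem_bot.mpr (hall z)
    have h1 : finrank F (⊥ : IntermediateField F E) = 1 := IntermediateField.finrank_bot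
    rw [hbt, IntermediateField.finrank_top'] at h1
    omega
  -- `1, x` is a basis of `E` over `F`
  have hli : LinearIndependent F ![(1 : E), x] := by
    refine LinearIndependent.pair_iff.2 fun s t hst => ?_
    rw [Algebra.smul_def, Algebra.smul_def, mul_one] at hst
    by_cases ht : t = 0
    · refine ⟨?_, ht⟩
      rw [ht, map_zero, zero_mul, add_zero] at hst
      exact (map_eq_zero _).mp hst
    · exfalso
      refine hx ⟨-s / t, ?_⟩
      have ht' : algebraMap F E t ≠ 0 := (_root_.map_ne_zero _).mpr ht
      rw [map_div₀, map_neg, div_eq_iff ht']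
      linear_combination -hst
  let b : Basis (Fin 2) F E := basisOfLinearIndependentOfCardEqFinrank hli (by simp [h2])
  have hb : ∀ z : E, z = algebraMap F E (b.repr z 0) + algebraMap F E (b.repr z 1) * x := by
    intro z
    conv_lhs => rw [← b.sum_repr z]
    rw [Fin.sum_univ_two]
    simp only [b, coe_basisOfLinearIndependentOfCardEqFinrank, Matrix.cons_val_zero,
      Matrix.cons_val_one, Algebra.smul_def, mul_one]
  -- `x² = p + q x`; complete the square: `y = 2 x - q`, `y² = 4 p + q²`
  obtain ⟨p, q, hpq⟩ : ∃ p q : F, x * x = algebraMap F E p + algebraMap F E q * x :=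
    ⟨_, _, hb (x * x)⟩
  refine ⟨4 * p + q * q, ?_, 2 * x - algebraMap F E q, ?_, fun z => ?_⟩
  · -- not a square in `F`: otherwise `y = ± r ∈ F` and `x ∈ F`
    rintro ⟨r, hr⟩
    have hprod : (2 * x - algebraMap F E q - algebraMap F E r) *
        (2 * x - algebraMap F E q + algebraMap F E r) = 0 := by
      have : algebraMap F E (4 * p + q * q) = algebraMap F E r * algebraMap F E r := by
        rw [hr, map_mul]
      simp only [map_add, map_mul, map_ofNat] at this
      linear_combination (4 : E) * hpq + this
    rcases mul_eq_zero.mp hprod with h | h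
    · refine hx ⟨(q + r) / 2, ?_⟩
      rw [map_div₀, map_add, map_ofNat, div_eq_iff (two_ne_zero' E)]
      linear_combination -h
    · refine hx ⟨(q - r) / 2, ?_⟩
      rw [map_div₀, map_sub, map_ofNat, div_eq_iff (two_ne_zero' E)]
      linear_combination -h
  · simp only [map_add, map_mul, map_ofNat]
    linear_combination (4 : E) * hpq
  · refine ⟨b.repr z 0 + b.repr z 1 * q / 2, b.repr z 1 / 2, ?_⟩
    conv_lhs => rw [hb z]
    simp only [map_add, map_mul, map_div₀, map_ofNat]
    field_simp
    ring

end Quadratic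

/-! ### Odd degree extensions, Sylow, and the degree bound -/

section Degree

variable {K : Type*} [Field K] [LinearOrder K] [IsStrictOrderedRing K] [IsRealClosed K]

/-- **Odd-degree extensions of a real closed field are trivial**: a primitive element has an
irreducible minimal polynomial of odd degree, which has a root in `K`, hence degree `1`
(Lang, *Undergraduate Algebra*, proof of Thm. VII.4.10). [folklore] -/
theorem finrank_eq_one_of_odd_finrank {F : Type*} [Field F] [Algebra K F] [FiniteDimensional K F]
    (hodd : Odd (finrank K F)) : finrank K F = 1 := by
  obtain ⟨α, hα⟩ := Field.exists_primitive_element K F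
  have hint : IsIntegral K α := IsIntegral.of_finite K α
  have h1 : finrank K F = (minpoly K α).natDegree := by
    rw [← IntermediateField.finrank_top', ← hα, IntermediateField.adjoin.finrank hint]
  rw [h1] at hodd ⊢
  obtain ⟨r, hr⟩ := IsRealClosed.exists_isRoot_of_odd_natDegree hodd
  have hdeg : (minpoly K α).degree = 1 :=
    degree_eq_one_of_irreducible_of_root (minpoly.irreducible hint) hr
  exact natDegree_eq_of_degree_eq_some hdeg

/-- **The Galois group of a finite Galois extension of a real closed field is a `2`-group**: the
fixed field of a Sylow `2`-subgroup has odd degree, hence is `K` (Lang, *Undergraduate Algebra*,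
proof of Thm. VII.4.10). [folklore] -/
theorem exists_card_aut_eq_two_pow {E : Type*} [Field E] [Algebra K E] [FiniteDimensional K E]
    [IsGalois K E] : ∃ m : ℕ, Nat.card (E ≃ₐ[K] E) = 2 ^ m := by
  haveI : Fact (Nat.Prime 2) := ⟨Nat.prime_two⟩
  obtain ⟨P⟩ : Nonempty (Sylow 2 (E ≃ₐ[K] E)) := inferInstance
  set F₀ : IntermediateField K E := IntermediateField.fixedField (P : Subgroup (E ≃ₐ[K] E))
    with hF₀
  have h1 : finrank F₀ E = Nat.card (P : Subgroup (E ≃ₐ[K] E)) :=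
    IntermediateField.finrank_fixedField_eq_card _
  have h2 : finrank K F₀ * finrank F₀ E = finrank K E := Module.finrank_mul_finrank K F₀ E
  have h3 : Nat.card (E ≃ₐ[K] E) = finrank K E := IsGalois.card_aut_eq_finrank K E
  have h4 : (P : Subgroup (E ≃ₐ[K] E)).index * Nat.card (P : Subgroup (E ≃ₐ[K] E)) =
      Nat.card (E ≃ₐ[K] E) := Subgroup.index_mul_card _
  have hpos : 0 < Nat.card (P : Subgroup (E ≃ₐ[K] E)) := Nat.card_pos
  have hidx : finrank K F₀ = (P : Subgroup (E ≃ₐ[K] E)).index := by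
    apply Nat.eq_of_mul_eq_mul_right hpos
    rw [h4, h3, ← h2, h1]
  have hodd : Odd (P : Subgroup (E ≃ₐ[K] E)).index :=
    Nat.odd_iff.mpr (Nat.two_dvd_ne_zero.mp (P.not_dvd_index))
  have hone : finrank K F₀ = 1 := finrank_eq_one_of_odd_finrank (hidx ▸ hodd)
  rw [hidx, Subgroup.index_eq_one] at hone
  obtain ⟨m, hm⟩ := IsPGroup.iff_card.mp P.isPGroup'
  refine ⟨m, ?_⟩
  rw [← hm, ← h4, hone, Subgroup.index_top, one_mul]

/-- In a finite Galois extension of degree `2 ^ (j + 1)` there is an intermediate field of degree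
`2` over the base (the fixed field of a subgroup of order `2 ^ j` of the Galois group, which exists
by Sylow's first theorem; Lang, *Undergraduate Algebra*, Thm. II.9.1 and proof of Thm. VII.4.10).
[folklore] -/
theorem exists_intermediateField_finrank_eq_two {F E : Type*} [Field F] [Field E] [Algebra F E]
    [FiniteDimensional F E] [IsGalois F E] {j : ℕ} (hj : finrank F E = 2 ^ (j + 1)) :
    ∃ M : IntermediateField F E, finrank F M = 2 := by
  haveI : Fact (Nat.Prime 2) := ⟨Nat.prime_two⟩
  have hG : Nat.card (E ≃ₐ[F] E) = 2 ^ (j + 1) := (IsGalois.card_aut_eq_finrank F E).trans hj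
  obtain ⟨H, hH⟩ := Sylow.exists_subgroup_card_pow_prime (G := E ≃ₐ[F] E) 2 (n := j)
    (by rw [hG]; exact pow_dvd_pow 2 (Nat.le_succ j))
  refine ⟨IntermediateField.fixedField H, ?_⟩
  have h1 : finrank (IntermediateField.fixedField H) E = 2 ^ j :=
    (IntermediateField.finrank_fixedField_eq_card H).trans hH
  have h2 := Module.finrank_mul_finrank F (IntermediateField.fixedField H) E
  rw [h1, hj, pow_succ, mul_comm] at h2
  exact Nat.eq_of_mul_eq_mul_left (pow_pos two_pos j) h2

/-- **Finite Galois extensions of a real closed field have degree `≤ 2`** (Artin; Lang,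
*Undergraduate Algebra*, proof of Thm. VII.4.10). If the degree `2 ^ m` were `≥ 4`, there would
be quadratic extensions `K ⊂ M₂ ⊂ M₁` inside `E`; but `M₂ = K(√a)` with `a < 0`, in which every
element is a square (`exists_sq_eq_of_mul_self_eq`), so `M₂` has no quadratic extension.
[folklore] -/
theorem finrank_le_two_of_isGalois {E : Type*} [Field E] [Algebra K E] [FiniteDimensional K E]
    [IsGalois K E] : finrank K E ≤ 2 := by
  obtain ⟨m, hm⟩ := exists_card_aut_eq_two_pow (K := K) (E := E)
  have hfin : finrank K E = 2 ^ m := (IsGalois.card_aut_eq_finrank K E).symm.trans hm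
  by_contra hlt
  obtain ⟨j, rfl⟩ : ∃ j, m = j + 2 := by
    refine ⟨m - 2, ?_⟩
    have : ¬ m ≤ 1 := fun h => hlt (by
      rw [hfin]
      calc (2 : ℕ) ^ m ≤ 2 ^ 1 := Nat.pow_le_pow_right two_pos h
        _ = 2 := pow_one 2)
    omega
  -- a quadratic subextension `M₂ / K`
  obtain ⟨M₂, hM₂⟩ := exists_intermediateField_finrank_eq_two (F := K) (E := E) (j := j + 1)
    (by rw [hfin])
  -- every element of `M₂` is a square in `M₂`
  have hsq : ∀ w : M₂, IsSquare w := by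
    obtain ⟨a, hna, y, hy, hrep⟩ := exists_gen_of_finrank_eq_two (F := K) (E := M₂) hM₂
    have ha : a < 0 := neg_of_not_isSquare hna
    intro w
    obtain ⟨u, v, rfl⟩ := hrep w
    obtain ⟨s, t, hst⟩ := exists_sq_eq_of_mul_self_eq ha hy u v
    exact ⟨_, by rw [← hst, sq]⟩
  -- `E / M₂` is Galois of degree `2 ^ (j + 1)`, so it has a quadratic subextension `M₁ / M₂`
  have hfin₂ : finrank M₂ E = 2 ^ (j + 1) := by
    have h := Module.finrank_mul_finrank K M₂ E
    rw [hM₂, hfin, pow_succ _ (j + 1), mul_comm (2 ^ (j + 1)) 2] at h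
    exact Nat.eq_of_mul_eq_mul_left two_pos h
  obtain ⟨M₁, hM₁⟩ := exists_intermediateField_finrank_eq_two (F := M₂) (E := E) (j := j) hfin₂
  obtain ⟨a₁, hna₁, -⟩ := exists_gen_of_finrank_eq_two (F := M₂) (E := M₁) hM₁
  exact hna₁ (hsq a₁)

/-- **Irreducible polynomials over a real closed field have degree at most `2`**
(Basu–Pollack–Roy 2006, Thm. 2.11 `a) ⇒ b)` with Prop. 2.19; Bochnak–Coste–Roy 1998, Thm. 1.2.2):
the splitting field of an irreducible `f` is a finite Galois extension of `K`, of degree `≤ 2` by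
`finrank_le_two_of_isGalois`, and it contains the stem field `K[X]/(f)` of degree `deg f`.
[cite: BasuPollackRoy2006, Thm. 2.11 and Prop. 2.19] -/
theorem natDegree_le_two_of_irreducible {f : K[X]} (hf : Irreducible f) : f.natDegree ≤ 2 := by
  have hsep : f.Separable := hf.separable
  haveI : IsGalois K f.SplittingField := IsGalois.of_separable_splitting_field hsep
  have hE : finrank K f.SplittingField ≤ 2 := finrank_le_two_of_isGalois
  have hf0 : f ≠ 0 := hf.ne_zero
  have hdeg : (f.map (algebraMap K f.SplittingField)).degree ≠ 0 := by
    rw [degree_map]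
    exact (degree_pos_of_irreducible hf).ne'
  obtain ⟨β, hβ⟩ := (SplittingField.splits f).exists_eval_eq_zero hdeg
  rw [eval_map_algebraMap] at hβ
  have hint : IsIntegral K β := IsIntegral.of_finite K β
  have hmin : minpoly K β = f * C f.leadingCoeff⁻¹ := (minpoly.eq_of_irreducible hf hβ).symm
  have h1 : finrank K K⟮β⟯ = f.natDegree := by
    rw [IntermediateField.adjoin.finrank hint, hmin, natDegree_mul_C]
    exact inv_ne_zero (leadingCoeff_ne_zero.mpr hf0)
  have h2 : finrank K K⟮β⟯ ≤ finrank K f.SplittingField := by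
    rw [← IntermediateField.finrank_top' (F := K) (E := f.SplittingField)]
    exact IntermediateField.finrank_le_of_le_right le_top
  omega

end Degree

end Literature.FieldTheory.RealClosed
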